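import Summits.NavierStokesRegularity.FluidComputer.PalasekTowerHeredityWitnessRungs

/-!
# REGISTER v2.3′: the heredity witness — NUMBERS OF RECORD, certified

Cell `ns-blowup`, seat `ns-blowup-ecbridge-6` (g3; D-0074 GROUP C «BRIDGE SUPPORT»; bears_on LADDER-NS N1,
route `PalasekTowerBreakdown`, child crux item stmt-NavierStokesRegularity-19249 `HeredityAtOne` —
by value `HeredityWitness 1` (`heredityAtOne_iff_heredityWitness_one`, p423427) — its parent 19178
`EpisodeInduction` and the base 19179 `EpisodeBase`; supports only, nothing claimed). Companion of
`PalasekTowerHeredityWitness.lean` (p417894: `Schedule.LevelWitness`, `HeredityWitness`) and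
`PalasekTowerHeredityWitnessRungs.lean` (p418125: the symbolic numbers `wide_Y_div_N`,
`Schedule.Rigid.window_length_wide`) and of ecbridge-5 g3's `PalasekTowerRegisterGlobalCoreWindow.lean`
(p432094: `TowerRates.wide_N_eq_two_rpow`, `log_wide_N`, and the window in diffusion units at the
CHILD scale, `36 < (τ₂ - τ₁) N₂² < 38` — here the complementary HOST-scale and absolute numbers).
LABEL: E–C typing, ARITHMETIC ONLY. WHAT THIS IS NOT: not
Navier–Stokes evidence — no stage, flow, tower or blow-up is constructed or asserted; these are
kernel-checked decimal enclosures of the constants at which the OPEN typed hypotheses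
`HeredityWitness 0` (base hand-over `0 → 1`) and `HeredityWitness 1` (item 19249, hand-over `1 → 2`)
are stated, so that the item text's «N₁ = 256^{1.1} ≈ 445 → N₂ ≈ 819», the memos' tables
(HOME/ecbridge6/HEREDITY-WITNESS*.md §4) and every MODEL «tower word» booked against the witness as an
ANALOGUE refer to certified numbers, not hand arithmetic.

## What is certified (wide-base rates `N₀ = 256`, `b = 11/10`, `β = 23/10`; rigid schedules:
## `c₁ = 1`, `c₂ = 5/3`, `c₅ = 4bβ = 253/25`; unit viscosity)

Everything is a dyadic power: `N_k = 2^{8 (11/10)^k}` (p432094 `TowerRates.wide_N_eq_two_rpow`,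
copied privately here),
`Y_k = N_k^{13/10}`, `A_k = N_k^{23/10}` (`wide_Y_eq_two_rpow`, `wide_A_eq_two_rpow`), so each
enclosure reduces to a comparison of natural-number powers (`lt_two_rpow_of_pow_lt`,
`two_rpow_lt_of_pow_lt`; exponents above `256` split as `a · m` for `norm_num`) decided by
`norm_num`, plus Mathlib's `Real.log_two_gt_d9` / `log_two_lt_d9` and `Real.pi_gt_d20` /
`pi_lt_d20` for the windows and loop lengths.

* scales: `445 < N₁ < 446`, `820 < N₂ < 821`; `1351 < Y₀ < 1352`, `2778 < Y₁ < 2779`,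
  `6139 < Y₂ < 6140`; `345901 < A₀ < 345902`, `1238360 < A₁ < 1238361`, `5036534 < A₂ < 5036535`;
  level Reynolds numbers `Y_k / N_k = N_k^{3/10}`: `6.233 < N₁^{3/10} < 6.234`,
  `7.484 < N₂^{3/10} < 7.485` (these are also the circulation floors `c₁ N_{k}^{β-2}`).
* hand-over `0 → 1` (`HeredityWitness 0`): window `τ₁ - τ₀ = (253/25) log N₁ / A₀ ∈
  (1.7845e-4, 1.7846e-4)` = between `61.72` and `61.73` strain times `1/A₀` = between `11.6` and
  `11.8` level-0 viscous times `1/N₀²`; window ceiling `(5/3) Y₁ ∈ (4630, 4632)`; floors at `τ₁`: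
  speed `≥ Y₁`, gradient `≥ A₁`, a loop of length `≤ 8π/N₁ ∈ (0.0563, 0.0567)` inside a ball of
  radius `1/N₁ ∈ (0.002242, 0.002248)` with circulation `≥ N₁^{3/10}`.
* hand-over `1 → 2` (`HeredityWitness 1` = item 19249 by value): window
  `τ₂ - τ₁ = (253/25) log N₂ / A₁ ∈ (5.483e-5, 5.484e-5)` = between `67.90` and `67.91` strain
  times `1/A₁` = between `10.8` and `11` level-1 viscous times `1/N₁²`; window ceiling
  `(5/3) Y₂ ∈ (10231, 10234)`; floors at `τ₂`: speed `≥ Y₂`, gradient `≥ A₂`, a loop of length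
  `≤ 8π/N₂ ∈ (0.0306, 0.0308)` inside a ball of radius `1/N₂ ∈ (0.001218, 0.00122)` with
  circulation `≥ N₂^{3/10}`.

References: S. Palasek, arXiv:2605.13827 §3.3–§4 (the rates) [cite: Palasek2026ElementaryModel, §4];
the register files cited above. All statements are [folklore] arithmetic.
-/

noncomputable section

namespace Summit.NavierStokesRegularity.FluidComputer.PalasekTowerClayBridge

open Real

namespace TowerRates

/-! ## §0 Two bracketing lemmas for dyadic powers -/

/-- Lower bracket of a dyadic power: if `q · r = a · m` and `x ^ r < (2 ^ a) ^ m` (naturals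
`a, m, r`; for `r = 0` the hypothesis is void) then `x < 2 ^ q`. (The exponent is split as `a · m` with `a ≤ 256` so that
`norm_num` evaluates the powers.) [folklore] -/
theorem lt_two_rpow_of_pow_lt {x q : ℝ} {a m r : ℕ} (hq : q * r = (a * m : ℕ))
    (h : x ^ r < ((2 : ℝ) ^ a) ^ m) : x < (2 : ℝ) ^ q := by
  refine lt_of_pow_lt_pow_left₀ r (by positivity) ?_
  rwa [← Real.rpow_natCast ((2 : ℝ) ^ q) r, ← Real.rpow_mul (by norm_num), hq,
    Real.rpow_natCast, pow_mul]

/-- Upper bracket of a dyadic power: if `q · r = a · m` and `(2 ^ a) ^ m < x ^ r` (naturals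
`a, m, r`, `x ≥ 0`) then `2 ^ q < x`. [folklore] -/
theorem two_rpow_lt_of_pow_lt {x q : ℝ} (hx : 0 ≤ x) {a m r : ℕ}
    (hq : q * r = (a * m : ℕ)) (h : ((2 : ℝ) ^ a) ^ m < x ^ r) : (2 : ℝ) ^ q < x := by
  refine lt_of_pow_lt_pow_left₀ r hx ?_
  rwa [← Real.rpow_natCast ((2 : ℝ) ^ q) r, ← Real.rpow_mul (by norm_num), hq,
    Real.rpow_natCast, pow_mul]

/-! ## §1 The wide rates as dyadic powers -/

/-- `N_k = 2^{8 · (11/10)^k}` on the wide-base rates — a `private` copy of ecbridge-5 g3's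
`TowerRates.wide_N_eq_two_rpow` (`PalasekTowerRegisterGlobalCoreWindow.lean`, p432094), kept local so
that this file does not wait for that module's olean on every farm node. [folklore] -/
private theorem wide_N_two_rpow (k : ℕ) : wide.N k = (2 : ℝ) ^ ((8 : ℝ) * (11 / 10) ^ k) := by
  simp only [TowerRates.N, wide]
  have h256 : (256 : ℝ) = (2 : ℝ) ^ (8 : ℝ) := by
    rw [show (8 : ℝ) = ((8 : ℕ) : ℝ) by norm_num, Real.rpow_natCast]; norm_num
  rw [h256, ← Real.rpow_mul (by norm_num)]

/-- `Y_k = 2^{8 · (11/10)^k · 13/10}` on the wide-base rates (`β - 1 = 13/10`). [folklore] -/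
theorem wide_Y_eq_two_rpow (k : ℕ) :
    wide.Y k = (2 : ℝ) ^ ((8 : ℝ) * (11 / 10) ^ k * (13 / 10)) := by
  have hβ : wide.β - 1 = 13 / 10 := by norm_num [wide]
  simp only [TowerRates.Y]
  rw [hβ, wide_N_two_rpow, ← Real.rpow_mul (by norm_num)]

/-- `A_k = 2^{8 · (11/10)^k · 23/10}` on the wide-base rates (`β = 23/10`). [folklore] -/
theorem wide_A_eq_two_rpow (k : ℕ) :
    wide.A k = (2 : ℝ) ^ ((8 : ℝ) * (11 / 10) ^ k * (23 / 10)) := by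
  have hβ : wide.β = 23 / 10 := by norm_num [wide]
  simp only [TowerRates.A]
  rw [hβ, wide_N_two_rpow, ← Real.rpow_mul (by norm_num)]

/-- The level Reynolds number / circulation floor exponent: `N_k^{β-2} = 2^{8 · (11/10)^k · 3/10}`.
[folklore] -/
theorem wide_N_rpow_sub_two_eq_two_rpow (k : ℕ) :
    wide.N k ^ (wide.β - 2) = (2 : ℝ) ^ ((8 : ℝ) * (11 / 10) ^ k * (3 / 10)) := by
  have hβ : wide.β - 2 = 3 / 10 := by norm_num [wide]
  rw [hβ, wide_N_two_rpow, ← Real.rpow_mul (by norm_num)]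

/-! ## §2 The scales `N₀, N₁, N₂`, `Y₀, Y₁, Y₂`, `A₀, A₁, A₂` and the level Reynolds numbers -/

/-- `N₀ = 256`. [folklore] -/
theorem wide_N_zero : wide.N 0 = 256 := by
  simp only [TowerRates.N, wide, pow_zero, Real.rpow_one]

/-- `N₁ = 256^{11/10} = 2^{44/5} ∈ (445, 446)` (`445⁵ < 2⁴⁴ < 446⁵`). [folklore] -/
theorem wide_N_one_bounds : 445 < wide.N 1 ∧ wide.N 1 < 446 := by
  rw [wide_N_two_rpow]
  exact ⟨lt_two_rpow_of_pow_lt (a := 44) (m := 1) (r := 5) (by norm_num) (by norm_num),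
    two_rpow_lt_of_pow_lt (by norm_num) (a := 44) (m := 1) (r := 5) (by norm_num) (by norm_num)⟩

/-- `N₂ = 256^{121/100} = 2^{242/25} ∈ (820, 821)` (the item text's «N₂ ≈ 819» is `820.3`).
[folklore] -/
theorem wide_N_two_bounds : 820 < wide.N 2 ∧ wide.N 2 < 821 := by
  rw [wide_N_two_rpow]
  exact ⟨lt_two_rpow_of_pow_lt (a := 242) (m := 1) (r := 25) (by norm_num) (by norm_num),
    two_rpow_lt_of_pow_lt (by norm_num) (a := 242) (m := 1) (r := 25) (by norm_num)
      (by norm_num)⟩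

/-- `Y₀ = 256^{13/10} = 2^{52/5} ∈ (1351, 1352)`. [folklore] -/
theorem wide_Y_zero_bounds : 1351 < wide.Y 0 ∧ wide.Y 0 < 1352 := by
  rw [wide_Y_eq_two_rpow]
  exact ⟨lt_two_rpow_of_pow_lt (a := 52) (m := 1) (r := 5) (by norm_num) (by norm_num),
    two_rpow_lt_of_pow_lt (by norm_num) (a := 52) (m := 1) (r := 5) (by norm_num) (by norm_num)⟩

/-- `Y₁ = 2^{286/25} ∈ (2778, 2779)`. [folklore] -/
theorem wide_Y_one_bounds : 2778 < wide.Y 1 ∧ wide.Y 1 < 2779 := by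
  rw [wide_Y_eq_two_rpow]
  exact ⟨lt_two_rpow_of_pow_lt (a := 143) (m := 2) (r := 25) (by norm_num) (by norm_num),
    two_rpow_lt_of_pow_lt (by norm_num) (a := 143) (m := 2) (r := 25) (by norm_num)
      (by norm_num)⟩

/-- `Y₂ = 2^{1573/125} ∈ (6139, 6140)` (the memos' «6140» is `6139.90…`). [folklore] -/
theorem wide_Y_two_bounds : 6139 < wide.Y 2 ∧ wide.Y 2 < 6140 := by
  rw [wide_Y_eq_two_rpow]
  exact ⟨lt_two_rpow_of_pow_lt (a := 143) (m := 11) (r := 125) (by norm_num) (by norm_num),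
    two_rpow_lt_of_pow_lt (by norm_num) (a := 143) (m := 11) (r := 125) (by norm_num)
      (by norm_num)⟩

/-- `A₀ = 2^{92/5} ∈ (345901, 345902)`. [folklore] -/
theorem wide_A_zero_bounds : 345901 < wide.A 0 ∧ wide.A 0 < 345902 := by
  rw [wide_A_eq_two_rpow]
  exact ⟨lt_two_rpow_of_pow_lt (a := 92) (m := 1) (r := 5) (by norm_num) (by norm_num),
    two_rpow_lt_of_pow_lt (by norm_num) (a := 92) (m := 1) (r := 5) (by norm_num) (by norm_num)⟩

/-- `A₁ = 2^{506/25} ∈ (1238360, 1238361)`. [folklore] -/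
theorem wide_A_one_bounds : 1238360 < wide.A 1 ∧ wide.A 1 < 1238361 := by
  rw [wide_A_eq_two_rpow]
  exact ⟨lt_two_rpow_of_pow_lt (a := 253) (m := 2) (r := 25) (by norm_num) (by norm_num),
    two_rpow_lt_of_pow_lt (by norm_num) (a := 253) (m := 2) (r := 25) (by norm_num)
      (by norm_num)⟩

/-- `A₂ = 2^{2783/125} ∈ (5036534, 5036535)`. [folklore] -/
theorem wide_A_two_bounds : 5036534 < wide.A 2 ∧ wide.A 2 < 5036535 := by
  rw [wide_A_eq_two_rpow]
  exact ⟨lt_two_rpow_of_pow_lt (a := 253) (m := 11) (r := 125) (by norm_num) (by norm_num),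
    two_rpow_lt_of_pow_lt (by norm_num) (a := 253) (m := 11) (r := 125) (by norm_num)
      (by norm_num)⟩

/-- Level-1 Reynolds number = level-1 circulation floor: `Y₁/N₁ = N₁^{3/10} = 2^{66/25} ∈
(6.233, 6.234)`. [folklore] -/
theorem wide_N_one_rpow_bounds :
    6.233 < wide.N 1 ^ (wide.β - 2) ∧ wide.N 1 ^ (wide.β - 2) < 6.234 := by
  rw [wide_N_rpow_sub_two_eq_two_rpow]
  exact ⟨lt_two_rpow_of_pow_lt (a := 66) (m := 1) (r := 25) (by norm_num) (by norm_num),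
    two_rpow_lt_of_pow_lt (by norm_num) (a := 66) (m := 1) (r := 25) (by norm_num)
      (by norm_num)⟩

/-- Level-2 Reynolds number = level-2 circulation floor: `Y₂/N₂ = N₂^{3/10} = 2^{363/125} ∈
(7.484, 7.485)`. [folklore] -/
theorem wide_N_two_rpow_bounds :
    7.484 < wide.N 2 ^ (wide.β - 2) ∧ wide.N 2 ^ (wide.β - 2) < 7.485 := by
  rw [wide_N_rpow_sub_two_eq_two_rpow]
  exact ⟨lt_two_rpow_of_pow_lt (a := 121) (m := 3) (r := 125) (by norm_num) (by norm_num),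
    two_rpow_lt_of_pow_lt (by norm_num) (a := 121) (m := 3) (r := 125) (by norm_num)
      (by norm_num)⟩

/-- `log N₁ = (44/5) log 2`. [folklore] -/
theorem wide_log_N_one : Real.log (wide.N 1) = 44 / 5 * Real.log 2 := by
  rw [wide_N_two_rpow, Real.log_rpow (by norm_num)]; norm_num

/-- `log N₂ = (242/25) log 2`. [folklore] -/
theorem wide_log_N_two : Real.log (wide.N 2) = 242 / 25 * Real.log 2 := by
  rw [wide_N_two_rpow, Real.log_rpow (by norm_num)]; norm_num

end TowerRates

open TowerRates

/-! ## §3 The two hand-over windows, in absolute, strain and viscous units -/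

variable {S : Schedule wide}

/-- **Window `0 → 1` in absolute units**: `τ₁ - τ₀ = (253/25) log N₁ / A₀ ∈ (1.7845e-4, 1.7846e-4)`
for every rigid schedule on the wide rates. [folklore] -/
theorem Schedule.Rigid.window_zero_bounds (h : S.Rigid) :
    (17845 : ℝ) / 10 ^ 8 < S.τ 1 - S.τ 0 ∧ S.τ 1 - S.τ 0 < 17846 / 10 ^ 8 := by
  have hw := h.window_length_wide 0
  rw [zero_add] at hw
  rw [hw, wide_log_N_one]
  obtain ⟨hA1, hA2⟩ := wide_A_zero_bounds
  have hl1 := Real.log_two_gt_d9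
  have hl2 := Real.log_two_lt_d9
  have hA : 0 < wide.A 0 := by linarith
  constructor
  · rw [lt_div_iff₀ hA]; nlinarith
  · rw [div_lt_iff₀ hA]; nlinarith

/-- **Window `1 → 2` in absolute units** (the window of item 19249): `τ₂ - τ₁ = (253/25) log N₂ / A₁
∈ (5.483e-5, 5.484e-5)` for every rigid schedule on the wide rates. [folklore] -/
theorem Schedule.Rigid.window_one_bounds (h : S.Rigid) :
    (5483 : ℝ) / 10 ^ 8 < S.τ 2 - S.τ 1 ∧ S.τ 2 - S.τ 1 < 5484 / 10 ^ 8 := by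
  have hw := h.window_length_wide 1
  rw [show (1 : ℕ) + 1 = 2 from rfl] at hw
  rw [hw, wide_log_N_two]
  obtain ⟨hA1, hA2⟩ := wide_A_one_bounds
  have hl1 := Real.log_two_gt_d9
  have hl2 := Real.log_two_lt_d9
  have hA : 0 < wide.A 1 := by linarith
  constructor
  · rw [lt_div_iff₀ hA]; nlinarith
  · rw [div_lt_iff₀ hA]; nlinarith

/-- **Window `0 → 1` in strain times**: `(τ₁ - τ₀) · A₀ = (253/25) log N₁ ∈ (61.72, 61.73)`.
[folklore] -/
theorem Schedule.Rigid.window_zero_strain_bounds (h : S.Rigid) :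
    61.72 < (S.τ 1 - S.τ 0) * wide.A 0 ∧ (S.τ 1 - S.τ 0) * wide.A 0 < 61.73 := by
  have hw := h.window_length_wide 0
  rw [zero_add] at hw
  have hA : 0 < wide.A 0 := by linarith [wide_A_zero_bounds.1]
  rw [hw, wide_log_N_one, div_mul_cancel₀ _ hA.ne']
  have hl1 := Real.log_two_gt_d9
  have hl2 := Real.log_two_lt_d9
  constructor <;> nlinarith

/-- **Window `1 → 2` in strain times**: `(τ₂ - τ₁) · A₁ = (253/25) log N₂ ∈ (67.90, 67.91)`.
[folklore] -/
theorem Schedule.Rigid.window_one_strain_bounds (h : S.Rigid) :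
    67.90 < (S.τ 2 - S.τ 1) * wide.A 1 ∧ (S.τ 2 - S.τ 1) * wide.A 1 < 67.91 := by
  have hw := h.window_length_wide 1
  rw [show (1 : ℕ) + 1 = 2 from rfl] at hw
  have hA : 0 < wide.A 1 := by linarith [wide_A_one_bounds.1]
  rw [hw, wide_log_N_two, div_mul_cancel₀ _ hA.ne']
  have hl1 := Real.log_two_gt_d9
  have hl2 := Real.log_two_lt_d9
  constructor <;> nlinarith

/-- **Window `0 → 1` in level-0 viscous times** (`ν = 1`, core scale `1/N₀`):
`(τ₁ - τ₀) · N₀² ∈ (11.6, 11.8)`. [folklore] -/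
theorem Schedule.Rigid.window_zero_viscous_bounds (h : S.Rigid) :
    11.6 < (S.τ 1 - S.τ 0) * wide.N 0 ^ 2 ∧ (S.τ 1 - S.τ 0) * wide.N 0 ^ 2 < 11.8 := by
  obtain ⟨h1, h2⟩ := h.window_zero_bounds
  rw [wide_N_zero]
  constructor <;> nlinarith

/-- **Window `1 → 2` in level-1 viscous times** (`ν = 1`, core scale `1/N₁`):
`(τ₂ - τ₁) · N₁² ∈ (10.8, 11)` (refuter K35 §6: «≈ 11 e-folds of plain diffusion at core scale»).
[folklore] -/
theorem Schedule.Rigid.window_one_viscous_bounds (h : S.Rigid) :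
    10.8 < (S.τ 2 - S.τ 1) * wide.N 1 ^ 2 ∧ (S.τ 2 - S.τ 1) * wide.N 1 ^ 2 < 11 := by
  obtain ⟨h1, h2⟩ := h.window_one_bounds
  obtain ⟨hN1, hN2⟩ := wide_N_one_bounds
  have hw : 0 ≤ S.τ 2 - S.τ 1 := by linarith
  have hlo : (445 : ℝ) ^ 2 < wide.N 1 ^ 2 := by nlinarith
  have hhi : wide.N 1 ^ 2 < (446 : ℝ) ^ 2 := by nlinarith
  have hsq : 0 ≤ wide.N 1 ^ 2 := sq_nonneg _
  constructor
  · have ha : (5483 : ℝ) / 10 ^ 8 * 445 ^ 2 < 5483 / 10 ^ 8 * wide.N 1 ^ 2 :=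
      mul_lt_mul_of_pos_left hlo (by norm_num)
    have hb : (5483 : ℝ) / 10 ^ 8 * wide.N 1 ^ 2 ≤ (S.τ 2 - S.τ 1) * wide.N 1 ^ 2 :=
      mul_le_mul_of_nonneg_right h1.le hsq
    linarith
  · have ha : (S.τ 2 - S.τ 1) * wide.N 1 ^ 2 ≤ (S.τ 2 - S.τ 1) * 446 ^ 2 :=
      mul_le_mul_of_nonneg_left hhi.le hw
    have hb : (S.τ 2 - S.τ 1) * (446 : ℝ) ^ 2 < 5484 / 10 ^ 8 * 446 ^ 2 :=
      mul_lt_mul_of_pos_right h2 (by norm_num)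
    linarith

/-! ## §4 The window ceilings and the readout floors of the two witnesses -/

/-- **Ceiling of the `0 → 1` window** (`LevelWitness … 0`: `‖v‖ ≤ c₂ Y₁` on `[τ₀, τ₁]`):
`c₂ Y₁ = (5/3) Y₁ ∈ (4630, 4632)` for every rigid schedule on the wide rates. [folklore] -/
theorem Schedule.Rigid.ceiling_one_bounds (h : S.Rigid) :
    4630 < S.c₂ * wide.Y 1 ∧ S.c₂ * wide.Y 1 < 4632 := by
  rw [h.c₂_eq]
  obtain ⟨h1, h2⟩ := wide_Y_one_bounds
  constructor <;> linarith

/-- **Ceiling of the `1 → 2` window** (`LevelWitness … 1`: `‖v‖ ≤ c₂ Y₂` on `[τ₁, τ₂]`):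
`c₂ Y₂ = (5/3) Y₂ ∈ (10231, 10234)` for every rigid schedule on the wide rates. [folklore] -/
theorem Schedule.Rigid.ceiling_two_bounds (h : S.Rigid) :
    10231 < S.c₂ * wide.Y 2 ∧ S.c₂ * wide.Y 2 < 10234 := by
  rw [h.c₂_eq]
  obtain ⟨h1, h2⟩ := wide_Y_two_bounds
  constructor <;> linarith

/-- **Floors read at `τ₁`** (`LevelWitness … 0`, rigid schedule: `c₁ = 1`): speed floor
`c₁ Y₁ ∈ (2778, 2779)`, gradient floor `c₁ A₁ ∈ (1238360, 1238361)`, loop length / loop speed bound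
`8π/N₁ ∈ (0.0563, 0.0567)`, core ball radius `1/N₁ ∈ (0.002242, 0.002248)`, circulation floor
`c₁ N₁^{β-2} ∈ (6.233, 6.234)`. [folklore] -/
theorem Schedule.Rigid.floors_one_bounds (h : S.Rigid) :
    (2778 < S.c₁ * wide.Y 1 ∧ S.c₁ * wide.Y 1 < 2779) ∧
    (1238360 < S.c₁ * wide.A 1 ∧ S.c₁ * wide.A 1 < 1238361) ∧
    (0.0563 < 8 * π / wide.N 1 ∧ 8 * π / wide.N 1 < 0.0567) ∧
    (0.002242 < 1 / wide.N 1 ∧ 1 / wide.N 1 < 0.002248) ∧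
    (6.233 < S.c₁ * wide.N 1 ^ (wide.β - 2) ∧ S.c₁ * wide.N 1 ^ (wide.β - 2) < 6.234) := by
  rw [h.c₁_eq]
  simp only [one_mul]
  obtain ⟨hN1, hN2⟩ := wide_N_one_bounds
  have hN : 0 < wide.N 1 := by linarith
  have hp1 := Real.pi_gt_d20
  have hp2 := Real.pi_lt_d20
  refine ⟨wide_Y_one_bounds, wide_A_one_bounds, ⟨?_, ?_⟩, ⟨?_, ?_⟩, wide_N_one_rpow_bounds⟩
  · rw [lt_div_iff₀ hN]; nlinarith
  · rw [div_lt_iff₀ hN]; nlinarith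
  · rw [lt_div_iff₀ hN]; nlinarith
  · rw [div_lt_iff₀ hN]; nlinarith

/-- **Floors read at `τ₂`** (`LevelWitness … 1` = the checklist of item 19249, rigid schedule:
`c₁ = 1`): speed floor `c₁ Y₂ ∈ (6139, 6140)`, gradient floor `c₁ A₂ ∈ (5036534, 5036535)`, loop
length / loop speed bound `8π/N₂ ∈ (0.0306, 0.0308)`, core ball radius
`1/N₂ ∈ (0.001218, 0.00122)`, circulation floor `c₁ N₂^{β-2} ∈ (7.484, 7.485)`. [folklore] -/
theorem Schedule.Rigid.floors_two_bounds (h : S.Rigid) :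
    (6139 < S.c₁ * wide.Y 2 ∧ S.c₁ * wide.Y 2 < 6140) ∧
    (5036534 < S.c₁ * wide.A 2 ∧ S.c₁ * wide.A 2 < 5036535) ∧
    (0.0306 < 8 * π / wide.N 2 ∧ 8 * π / wide.N 2 < 0.0308) ∧
    (0.001218 < 1 / wide.N 2 ∧ 1 / wide.N 2 < 0.00122) ∧
    (7.484 < S.c₁ * wide.N 2 ^ (wide.β - 2) ∧ S.c₁ * wide.N 2 ^ (wide.β - 2) < 7.485) := by
  rw [h.c₁_eq]
  simp only [one_mul]
  obtain ⟨hN1, hN2⟩ := wide_N_two_bounds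
  have hN : 0 < wide.N 2 := by linarith
  have hp1 := Real.pi_gt_d20
  have hp2 := Real.pi_lt_d20
  refine ⟨wide_Y_two_bounds, wide_A_two_bounds, ⟨?_, ?_⟩, ⟨?_, ?_⟩, wide_N_two_rpow_bounds⟩
  · rw [lt_div_iff₀ hN]; nlinarith
  · rw [div_lt_iff₀ hN]; nlinarith
  · rw [lt_div_iff₀ hN]; nlinarith
  · rw [div_lt_iff₀ hN]; nlinarith

/-- **The speed jump each witness must make** (autonomously at `1 → 2`): from below the previous
ceiling `c₂ Y_k` at `τ_k` to the next floor `c₁ Y_{k+1}` at `τ_{k+1}` — `(5/3) Y₀ < 2254 < 2778 < Y₁`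
and `(5/3) Y₁ < 4632 < 6139 < Y₂` (ratio `Y_{k+1} / (c₂ Y_k) = (3/5) N_k^{13/100} ≥ 1.19`). [folklore] -/
theorem Schedule.Rigid.jump_bounds (h : S.Rigid) :
    (S.c₂ * wide.Y 0 < 2254 ∧ 2778 < S.c₁ * wide.Y 1) ∧
    (S.c₂ * wide.Y 1 < 4632 ∧ 6139 < S.c₁ * wide.Y 2) := by
  rw [h.c₁_eq, h.c₂_eq]
  simp only [one_mul]
  obtain ⟨-, h0⟩ := wide_Y_zero_bounds
  obtain ⟨h1, h1'⟩ := wide_Y_one_bounds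
  obtain ⟨h2, -⟩ := wide_Y_two_bounds
  refine ⟨⟨by linarith, h1⟩, ⟨by linarith, h2⟩⟩

end Summit.NavierStokesRegularity.FluidComputer.PalasekTowerClayBridge

end
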